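/-
Copyright: lit-balaban cell, Phase-2 proof seat p24 (gen 23).  Released under Apache 2.0 license as described in the
file LICENSE.
-/
import Literature.MathematicalPhysics.QuantumFieldTheory.Balaban1983to89.B4Eq245Aliasing
import Literature.MathematicalPhysics.QuantumFieldTheory.Balaban1983to89.B4Eq246Fibre

/-!
# `Balaban1983to89.B4Eq246SummableSolution` — [Balaban1983RegularityDecay] p. 584, **«Solving this equation we obtain the
# following formula: (2.46)»** for EVERY summable solution `φ₀ = G_jf` of the basic equation (2.44): the synthesis of
# (2.43) (`B4Eq243Transform`/`B4Eq243TransformSummable`), (2.44) ⇒ (2.45) (`B4Eq245Aliasing`) and the fibrewise solution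
# (2.45) ⇒ (2.46) (`B4Eq246Fibre`)

statement-level skeleton of published theorems with citation tags; proofs where landed; nothing here is a claim about
the Yang–Mills mass gap

CITATION HEADER.  T. Bałaban, *Regularity and decay of lattice Green's functions*, Commun. Math. Phys. **89** (1983)
571–597, doi:10.1007/bf01214744 [Balaban1983RegularityDecay] (cell paper B4; held text
`paper:balaban1983-cmp89-regularity-decay`, journal page = PDF page + 570), p. 584 [PDF 14]; render
`pub-balaban/b2b-balaban-ref1/pages/1983-cmp89-regularity-decay/1983-cmp89-regularity-decay-p014-x2.png` read as an
image by this seat (unit `lit-balaban-p24` gen 23; HOME `run/shared/lean/pub/lit-balaban/`; SKELETON row **B4.Eq2.43** =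
displays (2.43)–(2.48); this is the synthesis file agreed with the B4 owner r01 (seat INBOX 2026-08-23T10:33:49Z) on top of
the three members of `lit-balaban-r01/AUDIT-B4-DEF-g42.md` §Plan).

WHAT IS PRINTED (p. 584, verbatim).  «We apply it to the basic equation (−Δ^ξ + m_j² + a_jQ_j^*Q_j)φ₀ = f. (2.44)  Defining the
propagator G_j, φ₀ = G_jf, we get
  Δ^ξ(p)φ̃₀(p) + a_ju_j(p) Σ_{l′} \overline{u_j(p′+l′)} φ̃₀(p′+l′) = f̃(p), […] (2.45)
Solving this equation we obtain the following formula: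
  φ̃₀(p′+l) = (1/Δ^ξ(p′+l)) f̃(p′+l) − (u_j(p′+l)/Δ^ξ(p′+l)) · a_j/(a_j Σ_{l′} |u_j(p′+l′)|²/Δ^ξ(p′+l′) + 1) ·
            Σ_{l′} (\overline{u_j(p′+l′)}/Δ^ξ(p′+l′)) f̃(p′+l′). (2.46)»

WHAT THIS MODULE PROVES (kernel-checked; theorems only; 0 `sorry`; 0 `Prop` facts; axioms standard).  For `n = L^j ≥ 1`,
a summable `φ₀ : ℤ^d → ℂ` (`Σ_z |φ₀(z)| < ∞`) with `(−Δ^ξ + m² + aQ_j^*Q_j)φ₀ = f` on the fine lattice (`B4Green244.opD n a m²`),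
and a real reduced momentum `p′` (fibre data `Δ k = DeltaXi n m² (shift n k p′)`, `u k = V n k p′`, `F k = ftSum n f (shift n k p′)`):
* **`ftSum_fibre_eq_sol246`** — under print's two non-vanishing conditions (`Δ^ξ(p′+l) ≠ 0` on the fibre and the bracket
  `a_jΣ|u_j|²/Δ^ξ + 1 ≠ 0`) THE FIBRE FAMILY `l ↦ φ̃₀(p′+l)` IS (2.46): `(k ↦ ftSum n φ₀ (shift n k p′)) = sol246 a Δ u F`
  (`B4Eq245Aliasing.eq245_of_eq244_real` fed into `B4Eq246Fibre.sol246_unique`);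
* `deltaXi_shift_ne_zero_of_pos`, `bracket246_ne_zero_of_pos` — both conditions HOLD for `m² > 0`, `a ≥ 0` at every real `p′`
  (`Re Δ^ξ ≥ m² > 0`, `Re bracket ≥ 1`), so **`ftSum_fibre_eq_sol246_of_pos`** is hypothesis-free there;
* **`ftSum_solution_eq_sol246`** — (2.46) read at `l = 0` through an ARBITRARY real momentum `q` (every fine momentum is the
  base point of its own fibre): `φ̃₀(q) = sol246 a Δ_q u_q F_q 0`, i.e. the transform of `G_jf` is an explicit functional of
  `f̃` on the fibre of `q`;
* **`solution_eq_latticeKernel_sol246`** — «φ₀ = G_jf» in position space: by the inversion theorem (2.43)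
  (`B4Eq243TransformSummable.ftSum_inversion_latticeKernel`) `φ₀(z) = (2π)^{−d}∫_{[−π,π]^d} n^d·sol246(…)(nP)·e^{iP·z} dP` —
  the formula (2.46) determines `G_jf` for a GENERAL summable `f`, closing HONEST SCOPE (iii) of `B4Green244` («only
  f = Q_j^*δ_y … not G_j itself»);
* **`solution_unique`** — consequently two summable solutions of (2.44) with the same `f` coincide (`m² > 0`, `a ≥ 0`):
  injectivity of `−Δ^ξ + m² + aQ_j^*Q_j` on `ℓ¹(ℤ^d)`, i.e. «the propagator G_j» is well defined as a left inverse there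
  (HONEST SCOPE (ii) of `B4Green244` for `ℓ¹`);
* **`solution_unique_of_nonneg`** — the same for ALL `m² ≥ 0`, `a ≥ 0` (lattice dimension `d ≥ 1`): at `m² = 0` the fibre of an
  exceptional `p′ ∈ (2πℤ)^d` degenerates (`Δ^ξ = 0` there), but the transforms of `ℓ¹` functions are continuous in the real
  momentum (`continuous_ftSum_ofRealVec`) and (2.46) pins them on the dense set of generic `p′` (`dense_generic_momenta`,
  `deltaXir_shiftr_pos_of_not_mem`), hence everywhere (`Continuous.ext_on`).

DICTIONARY / HONEST SCOPE.  (i) `a_j ↦` real `a ≥ 0` (print: `a_j > 0`); the explicit formula (2.46) is hypothesis-free for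
`m² > 0`, while for `m² = 0` (print allows `m² ≥ 0`) it holds at the generic `p′ ∉ (2πℤ)^d` through the conditional form
`ftSum_fibre_eq_sol246` (at `p′ ∈ (2πℤ)^d` one `Δ^ξ(p′+l)` vanishes and (2.46) is not defined as printed); uniqueness of the
summable solution holds for all `m² ≥ 0` (`solution_unique_of_nonneg`, `d ≥ 1`).  (ii) `φ₀ ∈ ℓ¹(ℤ^d)` is the standing class (it contains the
propagator columns by Lemma 2.4 / `B4Green244.K_decay`); `f = (2.44)(φ₀)` is then determined pointwise and needs no hypothesis.
(iii) EXISTENCE of a summable solution for a given summable `f` (i.e. surjectivity / the decay of `G_j` itself) is NOT claimed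
here — the tree has it for `f = Q_j^*δ_y` (`B4Green244.green244`, (2.47)–(2.48)); this file is the uniqueness-and-formula half
of «φ₀ = G_jf».  (iv) Fibre representatives `k_μ ∈ {0,…,n−1}`; scalar `φ`.  Value = kernel certificate of the sentence
«Solving this equation we obtain (2.46)» of [B4] §2 for general data; NOT summit progress.
-/

namespace Literature.MathematicalPhysics.QuantumFieldTheory.Balaban1983to89.B4Eq246SummableSolution

open Complex Finset MeasureTheory
open Literature.MathematicalPhysics.QuantumFieldTheory.Balaban1983to89.B4Strip
open Literature.MathematicalPhysics.QuantumFieldTheory.Balaban1983to89.B4ContourShift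
open Literature.MathematicalPhysics.QuantumFieldTheory.Balaban1983to89.B4StripSums
open Literature.MathematicalPhysics.QuantumFieldTheory.Balaban1983to89.B4Green244
open Literature.MathematicalPhysics.QuantumFieldTheory.Balaban1983to89.B4Eq243TransformSummable
open Literature.MathematicalPhysics.QuantumFieldTheory.Balaban1983to89.B4Eq245Aliasing
open Literature.MathematicalPhysics.QuantumFieldTheory.Balaban1983to89.B4Eq246Fibre
open scoped Real ComplexConjugate

noncomputable section

variable {d : ℕ}

/-! ### §1 The fibre family of a summable solution is (2.46) -/

/-- **THE FIBRE FAMILY OF A SUMMABLE SOLUTION OF (2.44) IS (2.46).**  If `(−Δ^ξ + m² + aQ_j^*Q_j)φ₀ = f` on `ξℤ^d` with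
`Σ_z|φ₀(z)| < ∞`, then at every real reduced momentum `p′` whose fibre data satisfy print's two non-vanishing conditions
(`Δ^ξ(p′+l) ≠ 0` for all `l`, and `a_jΣ_{l′}|u_j(p′+l′)|²/Δ^ξ(p′+l′) + 1 ≠ 0`) the family `l ↦ φ̃₀(p′+l)` is the right-hand side
of (2.46): `(k ↦ ftSum n φ₀ (shift n k p′)) = sol246 a Δ u F`. [cite: Balaban1983RegularityDecay, (2.44)–(2.46) p.584] -/
theorem ftSum_fibre_eq_sol246 (n : ℕ) [NeZero n] (a m2 : ℝ) {φ₀ f : (Fin d → ℤ) → ℂ} (hφ : Summable fun z => ‖φ₀ z‖)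
    (h : ∀ z, opD n a m2 φ₀ z = f z) (p : Fin d → ℝ)
    (hΔ : ∀ k : Fin d → Fin n, DeltaXi n m2 (shift n k (ofRealVec p)) ≠ 0)
    (hB : bracket246 (a : ℂ) (fun k : Fin d → Fin n => DeltaXi n m2 (shift n k (ofRealVec p)))
      (fun k => V n k (ofRealVec p)) ≠ 0) :
    (fun k : Fin d → Fin n => ftSum n φ₀ (shift n k (ofRealVec p)))
      = sol246 (a : ℂ) (fun k => DeltaXi n m2 (shift n k (ofRealVec p))) (fun k => V n k (ofRealVec p))
          (fun k => ftSum n f (shift n k (ofRealVec p))) :=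
  sol246_unique (a : ℂ) (fun k => V n k (ofRealVec p)) (fun k => ftSum n f (shift n k (ofRealVec p)))
    (fun k => ftSum n φ₀ (shift n k (ofRealVec p))) hΔ hB (fun k => eq245_of_eq244_real n a m2 hφ h p k)

/-! ### §2 Print's instance: the two non-vanishing conditions hold for `m² > 0`, `a ≥ 0` -/

/-- the fibre momenta of a real reduced momentum are real: `shift n k p′ = ofRealVec (shiftr n k p′)` and
`Δ^ξ(p′+2πk) = DeltaXir n m² (shiftr n k p′)` is a real number `≥ m²`. [cite: Balaban1983RegularityDecay, (2.45) p.584] -/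
theorem re_deltaXi_shift_ge (n : ℕ) (m2 : ℝ) (p : Fin d → ℝ) (k : Fin d → Fin n) :
    m2 ≤ (DeltaXi n m2 (shift n k (ofRealVec p))).re := by
  rw [shift_ofReal, DeltaXi_ofReal, Complex.ofReal_re]
  unfold DeltaXir
  have : 0 ≤ ∑ μ, Sxir n (shiftr n k p μ) := Finset.sum_nonneg (fun μ _ => Sxir_nonneg _ _)
  linarith

/-- `Δ^ξ(p′+l) ≠ 0` on every fibre when `m² > 0`. [cite: Balaban1983RegularityDecay, (2.45)–(2.46) p.584] -/
theorem deltaXi_shift_ne_zero_of_pos (n : ℕ) {m2 : ℝ} (hm : 0 < m2) (p : Fin d → ℝ) (k : Fin d → Fin n) :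
    DeltaXi n m2 (shift n k (ofRealVec p)) ≠ 0 := by
  intro h0
  have := re_deltaXi_shift_ge n m2 p k
  rw [h0, Complex.zero_re] at this
  linarith

/-- the printed bracket does not vanish as soon as every `Δ^ξ(p′+l′)` on the fibre is a positive real (`a ≥ 0`).
[cite: Balaban1983RegularityDecay, (2.46) p.584] -/
theorem bracket246_ne_zero_of_deltaXir_pos (n : ℕ) {a m2 : ℝ} (ha : 0 ≤ a) (p : Fin d → ℝ)
    (hpos : ∀ k : Fin d → Fin n, 0 < DeltaXir n m2 (shiftr n k p)) :
    bracket246 (a : ℂ) (fun k : Fin d → Fin n => DeltaXi n m2 (shift n k (ofRealVec p)))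
      (fun k => V n k (ofRealVec p)) ≠ 0 := by
  have hterm : ∀ k : Fin d → Fin n, ∃ r : ℝ, 0 ≤ r ∧
      ((‖V n k (ofRealVec p)‖ : ℂ) ^ 2) / DeltaXi n m2 (shift n k (ofRealVec p)) = (r : ℂ) := by
    intro k
    refine ⟨‖V n k (ofRealVec p)‖ ^ 2 / DeltaXir n m2 (shiftr n k p), div_nonneg (sq_nonneg _) (hpos k).le, ?_⟩
    rw [shift_ofReal, DeltaXi_ofReal]
    push_cast
    rfl
  choose r hr0 hr using hterm
  intro h0
  have hre : (bracket246 (a : ℂ) (fun k : Fin d → Fin n => DeltaXi n m2 (shift n k (ofRealVec p)))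
      (fun k => V n k (ofRealVec p))).re = a * ∑ k, r k + 1 := by
    rw [bracket246]
    simp_rw [hr]
    rw [show (a : ℂ) * ∑ k : Fin d → Fin n, (r k : ℂ) + 1 = ((a * ∑ k, r k + 1 : ℝ) : ℂ) by push_cast; ring,
      Complex.ofReal_re]
  rw [h0, Complex.zero_re] at hre
  have : 0 ≤ a * ∑ k, r k := mul_nonneg ha (Finset.sum_nonneg fun k _ => hr0 k)
  linarith

/-- the printed bracket has real part `≥ 1` for `a ≥ 0`, `m² > 0` (each `|u_j|²/Δ^ξ` is a non-negative real): in particular it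
does not vanish. [cite: Balaban1983RegularityDecay, (2.46) p.584] -/
theorem bracket246_ne_zero_of_pos (n : ℕ) {a m2 : ℝ} (ha : 0 ≤ a) (hm : 0 < m2) (p : Fin d → ℝ) :
    bracket246 (a : ℂ) (fun k : Fin d → Fin n => DeltaXi n m2 (shift n k (ofRealVec p)))
      (fun k => V n k (ofRealVec p)) ≠ 0 := by
  refine bracket246_ne_zero_of_deltaXir_pos n ha p fun k => ?_
  have := re_deltaXi_shift_ge n m2 p k
  rw [shift_ofReal, DeltaXi_ofReal, Complex.ofReal_re] at this
  linarith

/-- **(2.46) FOR EVERY SUMMABLE SOLUTION, HYPOTHESIS-FREE** (`m² > 0`, `a ≥ 0`, every real reduced momentum `p′`).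
[cite: Balaban1983RegularityDecay, (2.44)–(2.46) p.584] -/
theorem ftSum_fibre_eq_sol246_of_pos (n : ℕ) [NeZero n] {a m2 : ℝ} (ha : 0 ≤ a) (hm : 0 < m2) {φ₀ f : (Fin d → ℤ) → ℂ}
    (hφ : Summable fun z => ‖φ₀ z‖) (h : ∀ z, opD n a m2 φ₀ z = f z) (p : Fin d → ℝ) :
    (fun k : Fin d → Fin n => ftSum n φ₀ (shift n k (ofRealVec p)))
      = sol246 (a : ℂ) (fun k => DeltaXi n m2 (shift n k (ofRealVec p))) (fun k => V n k (ofRealVec p))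
          (fun k => ftSum n f (shift n k (ofRealVec p))) :=
  ftSum_fibre_eq_sol246 n a m2 hφ h p (deltaXi_shift_ne_zero_of_pos n hm p) (bracket246_ne_zero_of_pos n ha hm p)

/-! ### §3 (2.46) read back through (2.43): the transform and the values of `G_jf` -/

/-- **THE TRANSFORM OF `G_jf` AT AN ARBITRARY REAL MOMENTUM** (`m² > 0`, `a ≥ 0`): every real fine momentum `q` is the base point
of its own fibre, so (2.46) at `l = 0`, `p′ = q` gives `φ̃₀(q) = sol246 a Δ_q u_q F_q 0` — an explicit functional of `f̃` on the
fibre `q + 2πk`. [cite: Balaban1983RegularityDecay, (2.46) p.584] -/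
theorem ftSum_solution_eq_sol246 (n : ℕ) [NeZero n] {a m2 : ℝ} (ha : 0 ≤ a) (hm : 0 < m2) {φ₀ f : (Fin d → ℤ) → ℂ}
    (hφ : Summable fun z => ‖φ₀ z‖) (h : ∀ z, opD n a m2 φ₀ z = f z) (q : Fin d → ℝ) :
    ftSum n φ₀ (ofRealVec q)
      = sol246 (a : ℂ) (fun k : Fin d → Fin n => DeltaXi n m2 (shift n k (ofRealVec q))) (fun k => V n k (ofRealVec q))
          (fun k => ftSum n f (shift n k (ofRealVec q))) (fun _ => 0) := by
  have hfib := ftSum_fibre_eq_sol246_of_pos n ha hm hφ h q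
  have h0 := congrFun hfib (fun _ => (0 : Fin n))
  rw [shift_zero] at h0
  exact h0

/-- **«φ₀ = G_jf» IN POSITION SPACE**: a summable solution of (2.44) is the inverse transform (2.43) of the right-hand side of
(2.46): `φ₀(z) = (2π)^{−d}∫_{[−π,π]^d} n^d · sol246(…)(at q = nP, l = 0) · e^{iP·z} dP` (`B4ContourShift.latticeKernel`), for
`m² > 0`, `a ≥ 0` — the formula (2.46) determines `G_jf` for a general summable right-hand side `f`.
[cite: Balaban1983RegularityDecay, (2.43), (2.46) p.584] -/
theorem solution_eq_latticeKernel_sol246 (n : ℕ) [NeZero n] {a m2 : ℝ} (ha : 0 ≤ a) (hm : 0 < m2)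
    {φ₀ f : (Fin d → ℤ) → ℂ} (hφ : Summable fun z => ‖φ₀ z‖) (h : ∀ z, opD n a m2 φ₀ z = f z) (z : Fin d → ℤ) :
    φ₀ z = latticeKernel (fun P => (n : ℂ) ^ d * ftSum n φ₀ (fun μ => (n : ℂ) * P μ)) z
    ∧ ∀ P : Fin d → ℝ, ftSum n φ₀ (fun μ => (n : ℂ) * ofRealVec P μ)
        = sol246 (a : ℂ) (fun k : Fin d → Fin n => DeltaXi n m2 (shift n k (ofRealVec ((n : ℝ) • P))))
            (fun k => V n k (ofRealVec ((n : ℝ) • P))) (fun k => ftSum n f (shift n k (ofRealVec ((n : ℝ) • P))))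
            (fun _ => 0) := by
  refine ⟨ftSum_inversion_latticeKernel n (NeZero.ne n) hφ z, fun P => ?_⟩
  rw [← ftSum_solution_eq_sol246 n ha hm hφ h ((n : ℝ) • P)]
  congr 1
  funext μ
  simp [ofRealVec]

/-! ### §4 Uniqueness of summable solutions: `G_j` is a well-defined left inverse on `ℓ¹` -/

/-- **UNIQUENESS OF SUMMABLE SOLUTIONS OF (2.44)** (`m² > 0`, `a ≥ 0`): two `ℓ¹` functions with the same image under
`−Δ^ξ + m² + aQ_j^*Q_j` are equal — the operator is injective on `ℓ¹(ℤ^d)`, so «the propagator G_j, φ₀ = G_jf» names at most one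
summable `φ₀`. [cite: Balaban1983RegularityDecay, (2.44)–(2.46) p.584] -/
theorem solution_unique (n : ℕ) [NeZero n] {a m2 : ℝ} (ha : 0 ≤ a) (hm : 0 < m2) {φ₁ φ₂ : (Fin d → ℤ) → ℂ}
    (h₁ : Summable fun z => ‖φ₁ z‖) (h₂ : Summable fun z => ‖φ₂ z‖) (h : ∀ z, opD n a m2 φ₁ z = opD n a m2 φ₂ z) :
    φ₁ = φ₂ := by
  have hf : opD n a m2 φ₁ = opD n a m2 φ₂ := funext h
  refine eq_of_ftSum_eq n (NeZero.ne n) h₁ h₂ fun q _ => ?_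
  rw [ftSum_solution_eq_sol246 n ha hm h₁ (f := opD n a m2 φ₁) (fun z => rfl) q,
    ftSum_solution_eq_sol246 n ha hm h₂ (f := opD n a m2 φ₂) (fun z => rfl) q, hf]

/-- in particular the only summable solution of the homogeneous equation `(−Δ^ξ + m² + aQ_j^*Q_j)φ = 0` is `φ = 0`
(`m² > 0`, `a ≥ 0`). [cite: Balaban1983RegularityDecay, (2.44) p.584] -/
theorem solution_eq_zero_of_opD_eq_zero (n : ℕ) [NeZero n] {a m2 : ℝ} (ha : 0 ≤ a) (hm : 0 < m2) {φ : (Fin d → ℤ) → ℂ}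
    (hφ : Summable fun z => ‖φ z‖) (h : ∀ z, opD n a m2 φ z = 0) : φ = fun _ => 0 := by
  refine solution_unique n ha hm hφ (summable_zero.congr fun _ => by simp) fun z => ?_
  rw [h z]
  simp [opD, negLap, blockAvg]

/-- the fine plane wave at a real momentum has modulus one. [cite: Balaban1983RegularityDecay, (2.43) p.584, dictionary] -/
theorem norm_cexp_neg_phaseC_real (n : ℕ) (p : Fin d → ℝ) (z : Fin d → ℤ) :
    ‖cexp (-(I * phaseC (ofRealVec p) z / n))‖ = 1 := by
  rw [phaseC_ofRealVec]
  have hh : -(I * phase p z / n) = ((-(∑ μ, p μ * (z μ : ℝ)) / n : ℝ) : ℂ) * I := by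
    unfold phase; push_cast; ring
  rw [hh, Complex.norm_exp_ofReal_mul_I]

/-! ### §5 `m² ≥ 0`: uniqueness survives at the massless point by continuity of the transform -/

/-- the transform of an `ℓ¹` function is a continuous function of the real momentum (a uniformly convergent series of
plane waves). [cite: Balaban1983RegularityDecay, (2.43) p.584] -/
theorem continuous_ftSum_ofRealVec (n : ℕ) {φ : (Fin d → ℤ) → ℂ} (hφ : Summable fun z => ‖φ z‖) :
    Continuous fun p : Fin d → ℝ => ftSum n φ (ofRealVec p) := by
  unfold ftSum
  refine continuous_const.mul (continuous_tsum (fun z => ?_) hφ (fun z p => ?_))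
  · unfold ftTerm phaseC ofRealVec
    fun_prop
  · unfold ftTerm
    rw [norm_mul, norm_cexp_neg_phaseC_real, one_mul]

/-- off the lattice `(2πℤ)^d` of exceptional reduced momenta every `Δ^ξ(p′+l′)`, `m² ≥ 0`, is a POSITIVE real: if some
coordinate `p′_μ ∉ 2πℤ` then `p′_μ + 2πk_μ ∉ 2πnℤ` and `S_ξ(p′_μ + 2πk_μ) > 0`. [cite: Balaban1983RegularityDecay, (2.45) p.584] -/
theorem deltaXir_shiftr_pos_of_not_mem (n : ℕ) [NeZero n] {m2 : ℝ} (hm : 0 ≤ m2) {p : Fin d → ℝ} {μ : Fin d}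
    (hp : ∀ m : ℤ, p μ ≠ 2 * π * m) (k : Fin d → Fin n) : 0 < DeltaXir n m2 (shiftr n k p) := by
  have hn : n ≠ 0 := NeZero.ne n
  have hnr : (0 : ℝ) < n := by exact_mod_cast Nat.pos_of_ne_zero hn
  unfold DeltaXir
  have hS : 0 < Sxir n (shiftr n k p μ) := by
    rw [Sxir_eq]
    have hsin : Real.sin (shiftr n k p μ / (2 * n)) ≠ 0 := by
      intro h0
      obtain ⟨m, hm'⟩ := Real.sin_eq_zero_iff.mp h0
      apply hp (m * n - (k μ : ℕ))
      simp only [shiftr] at hm'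
      push_cast
      field_simp at hm'
      linarith
    positivity
  have hrest : 0 ≤ ∑ ν ∈ Finset.univ.erase μ, Sxir n (shiftr n k p ν) := Finset.sum_nonneg fun ν _ => Sxir_nonneg _ _
  rw [← Finset.add_sum_erase Finset.univ _ (Finset.mem_univ μ)]
  linarith

/-- the set of reduced momenta with NO coordinate in `2πℤ` is dense in `ℝ^d`. [cite: Balaban1983RegularityDecay, (2.45) p.584, dictionary] -/
theorem dense_generic_momenta (d : ℕ) : Dense {p : Fin d → ℝ | ∀ μ, ∀ m : ℤ, p μ ≠ 2 * π * m} := by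
  have h1 : Dense {x : ℝ | ∀ m : ℤ, x ≠ 2 * π * m} := by
    have : {x : ℝ | ∀ m : ℤ, x ≠ 2 * π * m} = (Set.range (fun m : ℤ => 2 * π * (m : ℝ)))ᶜ := by
      ext x; simp [eq_comm]
    rw [this]
    exact (Set.countable_range _).dense_compl ℝ
  have h2 := dense_pi (Set.univ : Set (Fin d)) (s := fun _ : Fin d => {x : ℝ | ∀ m : ℤ, x ≠ 2 * π * m}) (fun _ _ => h1)
  refine h2.mono ?_
  intro p hp μ
  exact hp μ (Set.mem_univ μ)

/-- **UNIQUENESS OF SUMMABLE SOLUTIONS OF (2.44) FOR ALL `m² ≥ 0`, `a ≥ 0`** (lattice dimension `d ≥ 1`): two `ℓ¹` functions with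
the same image under `−Δ^ξ + m² + aQ_j^*Q_j` coincide.  At the massless point the fibre of `p′ ∈ (2πℤ)^d` degenerates, but the
two transforms are continuous in the real momentum and agree on the dense set of generic `p′`, hence everywhere.
[cite: Balaban1983RegularityDecay, (2.44)–(2.46) p.584] -/
theorem solution_unique_of_nonneg (n : ℕ) [NeZero n] (hd : 0 < d) {a m2 : ℝ} (ha : 0 ≤ a) (hm : 0 ≤ m2)
    {φ₁ φ₂ : (Fin d → ℤ) → ℂ} (h₁ : Summable fun z => ‖φ₁ z‖) (h₂ : Summable fun z => ‖φ₂ z‖)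
    (h : ∀ z, opD n a m2 φ₁ z = opD n a m2 φ₂ z) : φ₁ = φ₂ := by
  have hf : opD n a m2 φ₁ = opD n a m2 φ₂ := funext h
  -- the two transforms agree at every generic momentum
  have hgen : Set.EqOn (fun p : Fin d → ℝ => ftSum n φ₁ (ofRealVec p)) (fun p => ftSum n φ₂ (ofRealVec p))
      {p : Fin d → ℝ | ∀ μ, ∀ m : ℤ, p μ ≠ 2 * π * m} := by
    intro p hp
    obtain ⟨μ⟩ : Nonempty (Fin d) := ⟨⟨0, hd⟩⟩
    have hpos : ∀ k : Fin d → Fin n, 0 < DeltaXir n m2 (shiftr n k p) :=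
      fun k => deltaXir_shiftr_pos_of_not_mem n hm (hp μ) k
    have hΔ : ∀ k : Fin d → Fin n, DeltaXi n m2 (shift n k (ofRealVec p)) ≠ 0 := by
      intro k h0
      have := hpos k
      rw [shift_ofReal, DeltaXi_ofReal, Complex.ofReal_eq_zero] at h0
      linarith
    have hB := bracket246_ne_zero_of_deltaXir_pos n ha p hpos
    have e1 := congrFun (ftSum_fibre_eq_sol246 n a m2 h₁ (f := opD n a m2 φ₁) (fun z => rfl) p hΔ hB) (fun _ => 0)
    have e2 := congrFun (ftSum_fibre_eq_sol246 n a m2 h₂ (f := opD n a m2 φ₂) (fun z => rfl) p hΔ hB) (fun _ => 0)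
    simp only [shift_zero] at e1 e2
    simp only
    rw [e1, e2, hf]
  have heq := Continuous.ext_on (dense_generic_momenta d) (continuous_ftSum_ofRealVec n h₁)
    (continuous_ftSum_ofRealVec n h₂) hgen
  exact eq_of_ftSum_eq n (NeZero.ne n) h₁ h₂ fun q _ => congrFun heq q

end

end Literature.MathematicalPhysics.QuantumFieldTheory.Balaban1983to89.B4Eq246SummableSolution
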